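import Summits.ValiantsHypothesis.ValiantsHypothesis.Theorems.NcSkewPermanent
import HarnessLib

/-!
# The skew rung is populated: a row-by-row skew circuit for the ordered permanent (kernel witness)

Workshop file for the node `CommutativityDial` (decomp-valiant lens 6 «restricted-models lifting axis»,
O-L6-12; companion of `NcSkewStructure` / `NcSkewPermanent`, which prove that every fan-in-two SKEW
noncommutative circuit for `PERM_n` has size `≥ 2^{⌊n/4⌋}/(⌊n/4⌋+1)`). This file supplies the
NON-VACUITY WITNESS of that rung (kill criterion K1 of the call): for every `n` and every
commutative semiring `R` there IS a fan-in-two skew circuit computing `ncPerPoly R n`, of size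
`≤ 2n · 2^n` — the column-by-column dynamic programme over the set of rows already used (Nisan's
`2^n`-layered branching program for the permanent, read as a circuit): the partial sum over injective
row sequences `r_0 … r_k` inside a row set `S`, `rowDP k S = Σ_{i ∈ S} rowDP (k−1) (S∖i) · x_{i,k}`,
multiplies by LETTERS on the right only, so every product gate is skew.

* §1 a skew twin of the gate-appending toolkit of `NcAutomatonIntersection` §2 (the appended product
  gates are `u · x` with `x` a letter; sums are free): `extend_prodVar`, `iterate_skew`;
* §2 the row DP in the free algebra: `rowDP_zero`, `rowDP_succ` (split off the last column,
  `Fin.snocEquiv`), `rowDP_top : rowDP n univ = ncPerPoly R n` (injective self-maps of `Fin n` are the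
  permutations);
* §3 `exists_skew_ncPerPoly` (size `≤ 2n·2^n`), `hasNcCircuitSizeLE_ncPerPoly`, and the TWO-SIDED
  skew rung `skew_rung_two_sided` (with `NcSkewPermanent.ncPerPoly_skew_floor`):
  `2^{⌊n/4⌋} ≤ (⌊n/4⌋+1)·size` for every skew circuit and `size ≤ 2n·2^n` for some.

HONEST FRAMING: an elementary upper bound (folklore; Nisan 1991), new in the kernel only; it shows the
skew rung of the `CommutativityDial` ladder is a statement about a NONEMPTY class and is tight up to
the constant in the exponent. Nothing here bears on general noncommutative circuits (`A_nc`, 23446) or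
on `VP ≠ VNP`.
-/

noncomputable section

namespace Summit.ValiantsHypothesis.ValiantsHypothesis.Theorems.NcSkewPermanentWitness

open Literature.Computability.AlgebraicComplexity
open Literature.Computability.AlgebraicComplexity.ArithCircuit
open Summit.ValiantsHypothesis.ValiantsHypothesis.Theorems.NcAutomatonIntersection

universe u v

/-! ## §1 Appending skew gates -/

section Toolkit

variable {R : Type u} [CommSemiring R] {σ : Type v}

/-- The value of a variable operand is the letter. [cite: Nisan1991Noncommutative, §1] -/
theorem ncEval_var (vals : List (FreeAlgebra R σ)) (x : σ) :
    (Operand.var x : Operand R σ).ncEval vals = FreeAlgebra.ι R x := rfl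

omit [CommSemiring R] in
/-- Appending a fan-in-two skew gate keeps a fan-in-two skew program. [cite: HuttenhainIkenmeyer2016, §5] -/
theorem good_append {gs : List (Gate R σ)} (hgs : ∀ g ∈ gs, g.fanIn ≤ 2 ∧ g.IsSkew) {g : Gate R σ}
    (hg : g.fanIn ≤ 2 ∧ g.IsSkew) : ∀ g' ∈ gs ++ [g], g'.fanIn ≤ 2 ∧ g'.IsSkew := by
  intro g' hg'
  rcases List.mem_append.mp hg' with h | h
  · exact hgs g' h
  · rw [List.mem_singleton.mp h]; exact hg

omit [CommSemiring R] in
/-- A product `u · x` by a LETTER `x` is a fan-in-two skew gate (at most the operand `u` refers to a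
gate). [cite: HuttenhainIkenmeyer2016, §5] -/
theorem good_prod_var (u : Operand R σ) (x : σ) :
    (Gate.prod [u, Operand.var x] : Gate R σ).fanIn ≤ 2 ∧
      (Gate.prod [u, Operand.var x] : Gate R σ).IsSkew := by
  refine ⟨by simp [Gate.fanIn, Gate.args], ?_⟩
  show [u, Operand.var x].countP Operand.isGateRef ≤ 1
  cases u <;> simp [Operand.isGateRef, List.countP_nil]

omit [CommSemiring R] in
/-- A binary weighted sum is a fan-in-two skew gate. [cite: HuttenhainIkenmeyer2016, §5] -/
theorem good_sum (a b : R) (u w : Operand R σ) :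
    (Gate.sum [(a, u), (b, w)] : Gate R σ).fanIn ≤ 2 ∧ (Gate.sum [(a, u), (b, w)] : Gate R σ).IsSkew :=
  ⟨by simp [Gate.fanIn, Gate.args], trivial⟩

/-- `≤ 2|T|` appended fan-in-two SKEW gates make `Σ_{t ∈ T} p_t · x_t` available, the `x_t` LETTERS
(each step: one product `p_t · x_t` by a letter, one sum). [cite: ArvindJoglekar2009, Thm 1] -/
theorem extend_prodVar {κ : Type*} (T : Finset κ) {gs : List (Gate R σ)}
    (hg : ∀ g ∈ gs, g.fanIn ≤ 2 ∧ g.IsSkew) (p : κ → FreeAlgebra R σ) (x : κ → σ)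
    (hp : ∀ t ∈ T, ∃ u : Operand R σ, u.RefsBelow gs.length ∧ u.ncEval (ncGateValues gs) = p t) :
    ∃ gs' : List (Gate R σ), gs <+: gs' ∧ (∀ g ∈ gs', g.fanIn ≤ 2 ∧ g.IsSkew) ∧
      gs'.length ≤ gs.length + 2 * T.card ∧
      ∃ u : Operand R σ, u.RefsBelow gs'.length ∧
        u.ncEval (ncGateValues gs') = ∑ t ∈ T, p t * FreeAlgebra.ι R (x t) := by
  classical
  induction T using Finset.induction_on with
  | empty => exact ⟨gs, List.prefix_rfl, hg, by simp, .const 0, trivial, by simp [Operand.ncEval]⟩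
  | @insert t T ht ih =>
    obtain ⟨gs₁, hpre₁, hg₁, hlen₁, acc, hacc, hacc_val⟩ :=
      ih fun s hs => hp s (Finset.mem_insert_of_mem hs)
    obtain ⟨u, -, hu_val⟩ := avail_mono hpre₁ (hp t (Finset.mem_insert_self t T))
    have hpre₂ : gs₁ <+: gs₁ ++ [Gate.prod [u, Operand.var (x t)]] := List.prefix_append _ _
    refine ⟨(gs₁ ++ [Gate.prod [u, Operand.var (x t)]]) ++
        [Gate.sum [((1 : R), acc), ((1 : R), Operand.gate gs₁.length)]],
      hpre₁.trans (hpre₂.trans (List.prefix_append _ _)),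
      good_append (good_append hg₁ (good_prod_var u (x t))) (good_sum _ _ _ _), ?_,
      Operand.gate (gs₁ ++ [Gate.prod [u, Operand.var (x t)]]).length, by simp [Operand.RefsBelow], ?_⟩
    · simp only [List.length_append, List.length_singleton, Finset.card_insert_of_notMem ht]
      omega
    · rw [ncEval_gate, ncGateValues_getD_length]
      simp only [Gate.ncEval, List.map_cons, List.map_nil, List.sum_cons, List.sum_nil, add_zero,
        one_smul]
      rw [operand_ncEval_of_prefix hpre₂ hacc, hacc_val, ncEval_gate, ncGateValues_getD_length,
        Finset.sum_insert ht, add_comm]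
      simp [Gate.ncEval, hu_val, ncEval_var]

/-- Targets each `≤ cost` skew gates away are jointly `≤ cost·|T|` skew gates away. [cite: ArvindJoglekar2009, Thm 1] -/
theorem iterate_skew {κ : Type*} (T : Finset κ) (goal : κ → FreeAlgebra R σ) (cost : ℕ)
    {gs : List (Gate R σ)} (hg : ∀ g ∈ gs, g.fanIn ≤ 2 ∧ g.IsSkew)
    (hstep : ∀ t ∈ T, ∀ gs' : List (Gate R σ), gs <+: gs' → (∀ g ∈ gs', g.fanIn ≤ 2 ∧ g.IsSkew) →
      ∃ gs'' : List (Gate R σ), gs' <+: gs'' ∧ (∀ g ∈ gs'', g.fanIn ≤ 2 ∧ g.IsSkew) ∧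
        gs''.length ≤ gs'.length + cost ∧
        ∃ u : Operand R σ, u.RefsBelow gs''.length ∧ u.ncEval (ncGateValues gs'') = goal t) :
    ∃ gs' : List (Gate R σ), gs <+: gs' ∧ (∀ g ∈ gs', g.fanIn ≤ 2 ∧ g.IsSkew) ∧
      gs'.length ≤ gs.length + cost * T.card ∧
      ∀ t ∈ T, ∃ u : Operand R σ, u.RefsBelow gs'.length ∧ u.ncEval (ncGateValues gs') = goal t := by
  classical
  induction T using Finset.induction_on with
  | empty => exact ⟨gs, List.prefix_rfl, hg, by simp, fun t ht => absurd ht (by simp)⟩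
  | @insert t T ht ih =>
    obtain ⟨gs₁, hpre₁, hg₁, hlen₁, havail₁⟩ := ih fun s hs => hstep s (Finset.mem_insert_of_mem hs)
    obtain ⟨gs₂, hpre₂, hg₂, hlen₂, havail₂⟩ := hstep t (Finset.mem_insert_self t T) gs₁ hpre₁ hg₁
    refine ⟨gs₂, hpre₁.trans hpre₂, hg₂, ?_, fun s hs => ?_⟩
    · rw [Finset.card_insert_of_notMem ht, Nat.mul_succ]
      omega
    · rcases Finset.mem_insert.mp hs with rfl | hs
      · exact havail₂
      · exact avail_mono hpre₂ (havail₁ s hs)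

end Toolkit

/-! ## §2 The row-set dynamic programme for the ordered permanent -/

section RowDP

variable (R : Type u) [CommSemiring R] (n : ℕ)

/-- The word `x_{f 0, 0} x_{f 1, 1} ⋯ x_{f (k−1), k−1}` of a row sequence `f` on the first `k ≤ n`
columns. [cite: Nisan1991Noncommutative, §1] -/
def seqWord {k : ℕ} (hk : k ≤ n) (f : Fin k → Fin n) : FreeAlgebra R (Fin n × Fin n) :=
  (List.ofFn fun t : Fin k => FreeAlgebra.ι R (f t, (⟨t.1, lt_of_lt_of_le t.2 hk⟩ : Fin n))).prod

/-- The ROW DP value at column count `k` and row set `S`: the sum of the words of the INJECTIVE row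
sequences of length `k` with all rows in `S` (for `|S| = k`: the ordered permanent of the `S × [0,k)`
minor; Nisan's layer-`k` nodes are the `k`-subsets). [cite: Nisan1991Noncommutative, §1] -/
def rowDP {k : ℕ} (hk : k ≤ n) (S : Finset (Fin n)) : FreeAlgebra R (Fin n × Fin n) :=
  ∑ f : Fin k → Fin n, if Function.Injective f ∧ ∀ t, f t ∈ S then seqWord R n hk f else 0

/-- Column count `0`: the empty word, `rowDP 0 S = 1`. [cite: Nisan1991Noncommutative, §1] -/
theorem rowDP_zero (S : Finset (Fin n)) : rowDP R n (k := 0) (Nat.zero_le n) S = 1 := by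
  rw [rowDP, Fintype.sum_unique, if_pos]
  · simp [seqWord]
  · exact ⟨Function.injective_of_subsingleton _, fun t => Fin.elim0 t⟩

/-- Appending a row: the word of `(g, i)` is the word of `g` times the letter `x_{i,k}`. [cite: Nisan1991Noncommutative, §1] -/
theorem seqWord_snoc {k : ℕ} (hk : k + 1 ≤ n) (g : Fin k → Fin n) (i : Fin n) :
    seqWord R n hk (Fin.snoc g i : Fin (k + 1) → Fin n) =
      seqWord R n (Nat.le_of_succ_le hk) g * FreeAlgebra.ι R (i, ⟨k, hk⟩) := by
  rw [seqWord, seqWord, List.ofFn_succ', List.concat_eq_append, List.prod_append,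
    List.prod_singleton]
  simp only [Fin.snoc_castSucc, Fin.snoc_last, Fin.val_castSucc, Fin.val_last]

/-- Reindexing a sum over row sequences of length `k+1` by (last row, the first `k` rows)
(`Fin.snocEquiv`). [cite: Nisan1991Noncommutative, §1] -/
theorem sum_snoc {M : Type*} [AddCommMonoid M] (k : ℕ) (F : (Fin (k + 1) → Fin n) → M) :
    ∑ f, F f = ∑ i : Fin n, ∑ g : Fin k → Fin n, F (Fin.snoc g i) := by
  rw [← (Fin.snocEquiv fun _ : Fin (k + 1) => Fin n).sum_comp, Fintype.sum_prod_type]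
  rfl

/-- **The DP recurrence** `rowDP (k+1) S = Σ_{i ∈ S} rowDP k (S ∖ i) · x_{i,k}` (split off the last
row; an injective sequence inside `S` is an injective sequence inside `S ∖ i` followed by `i ∈ S`).
[cite: Nisan1991Noncommutative, §1] -/
theorem rowDP_succ {k : ℕ} (hk : k + 1 ≤ n) (S : Finset (Fin n)) :
    rowDP R n hk S =
      ∑ i ∈ S, rowDP R n (Nat.le_of_succ_le hk) (S.erase i) * FreeAlgebra.ι R (i, ⟨k, hk⟩) := by
  classical
  rw [rowDP, sum_snoc, ← Finset.sum_subset (Finset.subset_univ S)]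
  · refine Finset.sum_congr rfl fun i hi => ?_
    rw [rowDP, Finset.sum_mul]
    refine Finset.sum_congr rfl fun g _ => ?_
    split_ifs with h₁ h₂ h₂
    · rw [seqWord_snoc]
    · exfalso
      refine h₂ ⟨(Fin.snoc_injective_iff.mp h₁.1).1, fun t => Finset.mem_erase.mpr ⟨fun h => ?_, ?_⟩⟩
      · exact (Fin.snoc_injective_iff.mp h₁.1).2 ⟨t, h⟩
      · have := h₁.2 (Fin.castSucc t)
        rwa [Fin.snoc_castSucc] at this
    · exfalso
      refine h₁ ⟨Fin.snoc_injective_iff.mpr ⟨h₂.1, ?_⟩, fun t => ?_⟩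
      · rintro ⟨t, ht⟩
        exact (Finset.mem_erase.mp (h₂.2 t)).1 ht
      · cases t using Fin.lastCases with
        | last => rw [Fin.snoc_last]; exact hi
        | cast j => rw [Fin.snoc_castSucc]; exact (Finset.mem_erase.mp (h₂.2 j)).2
    · rw [zero_mul]
  · intro i _ hi
    refine Finset.sum_eq_zero fun g _ => ?_
    rw [if_neg]
    rintro ⟨-, hmem⟩
    have := hmem (Fin.last k)
    rw [Fin.snoc_last] at this
    exact hi this

/-- **Top of the DP**: at column count `n` and row set `univ` the injective row sequences are the
permutations, `rowDP n univ = ncPerPoly R n`. [cite: Nisan1991Noncommutative, §1] -/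
theorem rowDP_top : rowDP R n le_rfl (Finset.univ : Finset (Fin n)) = ncPerPoly R n := by
  classical
  rw [rowDP, ncPerPoly]
  simp only [Finset.mem_univ, implies_true, and_true, seqWord, Fin.eta]
  rw [← Finset.sum_filter]
  symm
  refine Finset.sum_bij (fun π _ => ⇑π)
    (fun π _ => Finset.mem_filter.mpr ⟨Finset.mem_univ _, π.injective⟩)
    (fun π _ π' _ h => Equiv.ext (congrFun h)) (fun f hf => ?_) (fun π _ => rfl)
  obtain ⟨-, hf⟩ := Finset.mem_filter.mp hf
  exact ⟨Equiv.ofBijective f (Finite.injective_iff_bijective.mp hf), Finset.mem_univ _, rfl⟩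

/-- **The DP as a skew program**: after level `k`, every `rowDP k S` with `|S| = k` is available in a
fan-in-two skew program of length `≤ 2n · Σ_{j<k} C(n, j+1)` (level `j+1` costs `2(j+1) ≤ 2n` gates
per `(j+1)`-set). [cite: Nisan1991Noncommutative, §1] -/
theorem rowDP_avail : ∀ (k : ℕ) (hk : k ≤ n), ∃ gs : List (Gate R (Fin n × Fin n)),
    (∀ g ∈ gs, g.fanIn ≤ 2 ∧ g.IsSkew) ∧
      gs.length ≤ 2 * n * ∑ j ∈ Finset.range k, n.choose (j + 1) ∧
      ∀ S ∈ Finset.powersetCard k (Finset.univ : Finset (Fin n)), ∃ u : Operand R (Fin n × Fin n),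
        u.RefsBelow gs.length ∧ u.ncEval (ncGateValues gs) = rowDP R n hk S := by
  intro k
  induction k with
  | zero =>
    intro hk
    refine ⟨[], fun g hg => by simp at hg, by simp, fun S _ => ⟨.const 1, trivial, ?_⟩⟩
    rw [rowDP_zero]
    exact map_one (algebraMap R (FreeAlgebra R (Fin n × Fin n)))
  | succ k ih =>
    intro hk
    obtain ⟨gs, hg, hlen, hav⟩ := ih (Nat.le_of_succ_le hk)
    obtain ⟨gs', -, hg', hlen', hav'⟩ := iterate_skew (Finset.powersetCard (k + 1) Finset.univ)
      (rowDP R n hk) (2 * (k + 1)) hg (fun S hS gs₁ hpre₁ hg₁ => by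
        have hcard : S.card = k + 1 := (Finset.mem_powersetCard.mp hS).2
        obtain ⟨gs₂, hpre₂, hg₂, hlen₂, u, hu, hval⟩ := extend_prodVar S hg₁
          (fun i => rowDP R n (Nat.le_of_succ_le hk) (S.erase i)) (fun i => (i, (⟨k, hk⟩ : Fin n)))
          (fun i hi => avail_mono hpre₁ (hav (S.erase i) (Finset.mem_powersetCard.mpr
            ⟨Finset.subset_univ _, by rw [Finset.card_erase_of_mem hi, hcard, Nat.add_sub_cancel]⟩)))
        refine ⟨gs₂, hpre₂, hg₂, by rw [hcard] at hlen₂; exact hlen₂, u, hu, ?_⟩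
        rw [hval, rowDP_succ])
    refine ⟨gs', hg', ?_, hav'⟩
    rw [Finset.card_powersetCard, Finset.card_fin] at hlen'
    have h1 : 2 * (k + 1) * n.choose (k + 1) ≤ 2 * n * n.choose (k + 1) :=
      Nat.mul_le_mul_right _ (by omega)
    calc gs'.length ≤ gs.length + 2 * (k + 1) * n.choose (k + 1) := hlen'
      _ ≤ 2 * n * ∑ j ∈ Finset.range k, n.choose (j + 1) + 2 * n * n.choose (k + 1) :=
        add_le_add hlen h1
      _ = 2 * n * ∑ j ∈ Finset.range (k + 1), n.choose (j + 1) := by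
        rw [Finset.sum_range_succ, mul_add]

/-! ## §3 The witness -/

/-- **THE SKEW RUNG IS POPULATED** (every commutative semiring, every `n`): there is a fan-in-two SKEW
noncommutative circuit computing the ordered permanent `ncPerPoly R n`, of size `≤ 2n · 2^n` (the row
DP; Nisan's `2^n`-node branching program read as a circuit). [cite: Nisan1991Noncommutative, §1] -/
theorem exists_skew_ncPerPoly : ∃ P : ArithCircuit R (Fin n × Fin n),
    P.IsFanInTwo ∧ P.IsSkew ∧ P.ncEval = ncPerPoly R n ∧ P.size ≤ 2 * n * 2 ^ n := by
  obtain ⟨gs, hg, hlen, hav⟩ := rowDP_avail R n n le_rfl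
  obtain ⟨u, -, hu⟩ := hav Finset.univ
    (Finset.mem_powersetCard.mpr ⟨Finset.Subset.refl _, Finset.card_fin n⟩)
  refine ⟨⟨gs, u⟩, fun g hg' => (hg g hg').1, fun g hg' => (hg g hg').2, ?_, ?_⟩
  · show u.ncEval (ncGateValues gs) = ncPerPoly R n
    rw [hu, rowDP_top]
  · show gs.length ≤ 2 * n * 2 ^ n
    refine hlen.trans (Nat.mul_le_mul_left _ ?_)
    have h := Nat.sum_range_choose n
    rw [Finset.sum_range_succ'] at h
    omega

/-- The same in the Literature's size predicate: `HasNcCircuitSizeLE (ncPerPoly R n) (2n·2^n)`.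
[cite: Nisan1991Noncommutative, §1] -/
theorem hasNcCircuitSizeLE_ncPerPoly : HasNcCircuitSizeLE (ncPerPoly R n) (2 * n * 2 ^ n) := by
  obtain ⟨P, h2, -, h, hs⟩ := exists_skew_ncPerPoly R n
  exact ⟨P, h2, h, hs⟩

end RowDP

/-- **THE SKEW RUNG, TWO-SIDED** (`n ≥ 4`, any field): SOME fan-in-two skew noncommutative circuit
computes `PERM_n` with `≤ 2n · 2^n` gates, and EVERY one has `2^{⌊n/4⌋} ≤ (⌊n/4⌋ + 1) · size`
(`NcSkewPermanent.ncPerPoly_skew_floor`, Limaye–Malod–Srinivasan 2016 §7): the kernel rung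
«skew circuits for the permanent are exponential» speaks about a nonempty class and is tight up to the
constant in the exponent. [cite: LimayeMalodSrinivasan2016, §7] -/
theorem skew_rung_two_sided (K : Type u) [Field K] {n : ℕ} (hn : 4 ≤ n) :
    (∃ P : ArithCircuit K (Fin n × Fin n), P.IsFanInTwo ∧ P.IsSkew ∧ P.ncEval = ncPerPoly K n ∧
        P.size ≤ 2 * n * 2 ^ n) ∧
      ∀ P : ArithCircuit K (Fin n × Fin n), P.IsFanInTwo → P.IsSkew → P.ncEval = ncPerPoly K n →
        2 ^ (n / 4) ≤ (n / 4 + 1) * P.size :=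
  ⟨exists_skew_ncPerPoly K n, fun P h2 hs h => NcSkewPermanent.ncPerPoly_skew_floor K hn P h2 hs h⟩

end Summit.ValiantsHypothesis.ValiantsHypothesis.Theorems.NcSkewPermanentWitness

end
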